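import Literature.MathematicalPhysics.QuantumFieldTheory.Balaban1983to89.B15Prop1GaugeLetterLocOfForestPackage
import Literature.MathematicalPhysics.QuantumFieldTheory.Balaban1983to89.B15Prop1GaugeLetterTargetOfLinearBudgets

/-!
# `Balaban1983to89.B15Prop1GaugeLetterSocketOfForestPackage` — [Balaban1985Variational] (2),(4) p. 278, Thm 1 (8) p. 279, (16)–(18) p. 280; [Balaban1988Convergent] (2.2) p. 255,
# (2.11)–(2.13) pp. 256–257; [Balaban1989LargeFieldI] Prop. 1 p. 194 («for ε > 0 sufficiently small»): ★★ THE ∀δ∃e GAUGE-LETTER SOCKET OF THE ASSEMBLED N12 ENDPOINTS FROM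
# dag-n12-w6's FOREST-PACKAGE PRODUCER WITH BUDGETS LINEAR IN THE GUARD

Honest framing: statement-level skeleton of published theorems with citation tags; proofs where landed; nothing here is a claim about the Yang–Mills mass gap.

Cell `pub-ymgap`, HUMAN RULINGS D-0062 ∕ D-0149 ∕ D-0154, width seat `pub-ymgap-dag-n12-w5` (g5) on node N12 = [B15]; count-neutral helper of K1⁹ `stmt-QuantumFields-27364`.  dag-n12-d
g18's successor trigger (t92) («a (σ)_N-discharging endpoint: n12-w6 `B15Prop1GaugeLetterLocOfForestPackage` ⇒ n12-w5 (vi) with `hσN ↦ hL + forest words + (gN1)`»); dag-n12-w6 g2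
(«(o6a) = yours; I type nothing between my §3 and your socket»).

WHY.  dag-n12-w6 g2's `exists_gaugeLetterLoc_atRecord_of_forestPackage` (p640962) delivers, for ONE base field's datum (`ρn`-near `1` on a region `𝒞`) and ONE minimiser `U₀`, the
localised gauge letter with the tolerance `max ρn (((2ℓ+1+ℓT)²∕4)·εP + eT + dG)` from: the rooted tower-forest package of `𝐁_k(Z)` (dag-n12-w3), word ∕ transporter budgets, the
`N`-geometry, a GRADED ROOT-FREE PLAQUETTE LETTER `PlaqSmallOn S εP U₀` at the minimiser ((1.7) ∕ [15] Thm 1) and the ROOT-TRANSPORTER LETTER (budgets `eT`, `dG`; [15] (16)–(18)).  The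
assembled endpoints of this lineage ((iv) p637658, (v) p639701) ask the letter in the ∀δ∃e form over the (1.74) guard.  THIS FILE closes the gap for a producer whose two displayed
letters are LINEAR IN THE GUARD (`εP = cP·e`, `eT = cT·e`, `dG = cG·e` at every guarded base field `V_k` — guard `e ≤ e₀` on `Z ∩ Λᶜ`, datum `ρlin·e` on the region box — and every
minimiser): §1 gives the `hlin` premise of `B15Prop1GaugeLetterTargetOfLinearBudgets.forall_target_exists_guard_of_linear` with the modulus `Cσ := ρlin + ((2ℓ+1+ℓT)²∕4)·cP + cT +
cG`; §2 the ∀δ∃e socket itself — so (vi) replaces the `hσN` binder of (v) by the forest package + budgets + `N`-geometry + the two linear letter families, by name.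

WHAT THIS FILE PROVES (no `sorry`, no definition; axioms standard).
§1 ★ `hlin_of_forestPackage_linear`; §2 ★★ `hσN_of_forestPackage_linear`.

HONEST SCOPE.  Composition by name + real arithmetic; the forest package, the plaquette letter at the minimiser ([15] Thm 1 ∕ (1.7)), the root-transporter letter ([15] (16)–(18)) and
the `N`-geometry stay HYPOTHESES (their linearity in the guard is the shape asked of the [15] door and of dag-n12-w3's transporter, not proved here); nothing of Bałaban's is asserted;
count-neutral; NOT a discharge of N12; K1 NOT closed; one finite four-torus programme at fixed `ε = L^{-K}` — nothing continuum ∕ ℝ⁴ ∕ OS ∕ mass-gap ∕ Clay.  No `def`, no `instance`,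
no `sorry`.

## References
* [Balaban1985Variational] T. Bałaban, Commun. Math. Phys. 102 (1985) 277–309, (2),(4) p. 278, Thm 1 (8) p. 279, (16)–(18) p. 280.
* [Balaban1985RegularSpaces] T. Bałaban, Commun. Math. Phys. 98 (1985), (1.7) p. 77, (1.19) p. 79.
* [Balaban1988Convergent] T. Bałaban, Commun. Math. Phys. 119 (1988) 243–285, (2.2) p. 255, (2.11)–(2.13) pp. 256–257, (2.16) p. 257.
* [Balaban1989LargeFieldI] T. Bałaban, Commun. Math. Phys. 122 (1989) 175–202, (1.74) p. 192, Prop. 1 (1.77)–(1.78) p. 194.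
-/

noncomputable section

open Set
open scoped Matrix.Norms.L2Operator BigOperators

namespace Literature.MathematicalPhysics.QuantumFieldTheory.Balaban1983to89.B15Prop1GaugeLetterSocketOfForestPackage

open T4Continuum GaugeField B15DeterminingSets
open T4CubeChartGnomonic (SU2)
open B16Sect1Backgrounds (toMS)
open T4AxialGaugeSmallField (castSite castSite_apply boxPlaqs boxBonds)
open B14.Eq213DetSet (Bj maxDomT)
open B14.Eq216Concrete (inputs)
open B14.Eq22Determines (blockIter)
open B5Eq118OneStroke (iterBlockOf)
open B15Prop1Carrier (plaqsInside)
open Literature.MathematicalPhysics.QuantumFieldTheory.BalabanImbrieJaffe1984to88.BIJ85Eq453GaugeField (qsstarGIter0)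
open B15Prop1GaugeLetterLocOfForestPackage (exists_gaugeLetterLoc_atRecord_of_forestPackage)
open B15Prop1GaugeLetterTargetOfLinearBudgets (forall_target_exists_guard_of_linear)

/-! ## §1  The linear producer premise `hlin` from the forest package and two linear letter families -/

/-- ★ **`hlin` FROM THE FOREST PACKAGE.**  At every guard `e ∈ (0, e₀]`, every base field `V_k` of the guard whose extended datum is `ρlin·e`-near `1` on the region box, and every
(2.12) minimiser `U₀`: dag-n12-w6 g2's `exists_gaugeLetterLoc_atRecord_of_forestPackage` at `W := ext V_k`, `𝒞 := boxBonds LO HI`, `ρn := ρlin·e`, `εP := cP·e`, `eT := cT·e`,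
`dG := cG·e`, followed by `max ρn (c·εP + eT + dG) ≤ (ρlin + c·cP + cT + cG)·e` — the premise `hlin` of `forall_target_exists_guard_of_linear` with that modulus.  The forest package,
the budgets, the `N`-geometry and the two LINEAR letter families are hypotheses, verbatim in the producer's shape.
[cite: Balaban1985Variational, (2),(4) p.278, Thm 1 (8) p.279, (16)–(18) p.280; Balaban1988Convergent, (2.2) p.255, (2.11)–(2.13) pp.256–257, (2.16) p.257; Balaban1989LargeFieldI, Prop. 1 p.194] -/
theorem hlin_of_forestPackage_linear {F : T4Family} (ν : Node00.Stage7Numerics) (Kt : ℕ) {k : ℕ} (hk0 : 0 < k)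
    (hk : k ≤ (F.P Kt).m + (F.P Kt).K) (Z : Set (Site (F.P Kt) 0))
    -- the rooted tower forest package, by shape
    (path : Site (F.P Kt) 0 → List (LStep (F.P Kt) 0)) (root : Site (F.P Kt) 0 → Site (F.P Kt) 0)
    (hF2 : ∀ j, j ≤ k → ∀ c ∈ bondsOf (Bj ν.M₁ Z k j), path (embIter j c.src) = [] ∧ path (embIter j c.tgt) = [])
    (hwalk : ∀ x, path x = walk (root x) ((path x).map fun s => (s.bond.dir, s.fwd)) ∧
      walkEnd (root x) ((path x).map fun s => (s.bond.dir, s.fwd)) = x)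
    (hpkg : ∀ (z : Site (F.P Kt) 0) (j : ℕ), j ≤ k →
      embIter j (iterBlockOf j z) ∈ {z : Site (F.P Kt) 0 | ∃ j, j ≤ k ∧ ∃ c ∈ bondsOf ((Bj ν.M₁ Z k : DetSet (F.P Kt)) j), (z = embIter j c.src ∨ z = embIter j c.tgt)} →
      (∀ s ∈ path z, iterBlockOf j s.bond.src = iterBlockOf j z ∧ iterBlockOf j s.bond.tgt = iterBlockOf j z) ∧
      (path z).length ≤ ∑ i ∈ Finset.range (j + 1), ((F.P Kt).d * (((F.P Kt).L ^ i - 1) / 2) + 1) ∧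
      (∀ ν', netDisp ((path z).map fun s => (s.bond.dir, s.fwd)) ν' = ((z ν').val : ℤ) - ((root z ν').val : ℤ)) ∧
      iterBlockOf j (root z) = iterBlockOf j z)
    (hcov : ∀ z : Site (F.P Kt) 0, ∃ J, J ≤ k ∧ iterBlockOf J z ∈ (Bj ν.M₁ Z k : DetSet (F.P Kt)) J)
    -- budgets: per-site word bounds, per-bond transporter bounds, uniform caps (no wrapping)
    (ℓs : Site (F.P Kt) 0 → ℕ) (hℓs : ∀ x ∈ maxDomT ν.M₁ Z 1, (path x).length ≤ ℓs x)
    (ℓb : PBond (F.P Kt) 0 → ℕ) {ℓ ℓT : ℕ} (hcapS : ∀ x ∈ maxDomT ν.M₁ Z 1, ℓs x ≤ ℓ)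
    (hcapB : ∀ b : PBond (F.P Kt) 0, b.src ∈ maxDomT ν.M₁ Z 1 → b.tgt ∈ maxDomT ν.M₁ Z 1 → ℓb b ≤ ℓT) (hN : 2 * ℓ + 1 + ℓT < (F.P Kt).sitesPerDir 0)
    -- the socket's objects: the base fields' extension `ext`, the complement box `Λ`, the region box `[LO, HI]` with sizes `n n'` (datum tolerance `ρlin·e`, the endpoints' `hρn` text)
    (Λ : Set (Site (F.P Kt) 0)) (ext : GaugeField (F.P Kt) k SU2 → GaugeField (F.P Kt) k SU2) (LO HI : Fin (F.P Kt).d → ℤ) (n n' : ℕ)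
    -- geometry of the neighbourhood
    (N : Set (PBond (F.P Kt) 0))
    (hGN : ∀ b ∈ N, (b.src ∉ maxDomT ν.M₁ Z 1 ∨ b.tgt ∉ maxDomT ν.M₁ Z 1) → blockIter k b.tgt ≠ blockIter k b.src →
      (⟨blockIter k b.src, b.dir⟩ : PBond (F.P Kt) k) ∈ (boxBonds LO HI : Set (PBond (F.P Kt) k)))
    (hN1 : ∀ p : Plaq (F.P Kt) 0, ((⟨p.src, p.μ⟩ : PBond (F.P Kt) 0) ∈ {b : PBond (F.P Kt) 0 | b.src ∈ maxDomT ν.M₁ Z 1} ∨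
        (⟨p.src.shift p.μ, p.ν⟩ : PBond (F.P Kt) 0) ∈ {b : PBond (F.P Kt) 0 | b.src ∈ maxDomT ν.M₁ Z 1} ∨
        (⟨p.src.shift p.ν, p.μ⟩ : PBond (F.P Kt) 0) ∈ {b : PBond (F.P Kt) 0 | b.src ∈ maxDomT ν.M₁ Z 1} ∨
        (⟨p.src, p.ν⟩ : PBond (F.P Kt) 0) ∈ {b : PBond (F.P Kt) 0 | b.src ∈ maxDomT ν.M₁ Z 1}) →
      (⟨p.src, p.μ⟩ : PBond (F.P Kt) 0) ∈ N ∧ (⟨p.src.shift p.μ, p.ν⟩ : PBond (F.P Kt) 0) ∈ N ∧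
        (⟨p.src.shift p.ν, p.μ⟩ : PBond (F.P Kt) 0) ∈ N ∧ (⟨p.src, p.ν⟩ : PBond (F.P Kt) 0) ∈ N)
    -- the reference guard and the LINEAR budgets of the two displayed letters
    {e₀ cP cT cG : ℝ} (hcP : 0 ≤ cP) (hcT : 0 ≤ cT) (hcG : 0 ≤ cG)
    -- DISPLAYED, LINEAR IN THE GUARD: the graded root-free plaquette letter ((1.7) ∕ [15] Thm 1 at the minimiser) on `S`, for every guarded base field and every minimiser
    {S : Set (Plaq (F.P Kt) 0)}
    (hP : ∀ e : ℝ, 0 < e → e ≤ e₀ → ∀ (Vk : GaugeField (F.P Kt) k SU2), PlaqSmallOn (plaqsInside (pts k (Z ∩ Λᶜ))) e Vk →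
      (∀ b ∈ (boxBonds LO HI : Set (PBond (F.P Kt) k)), dist1 (ext Vk b) ≤
        (((F.P Kt).d : ℝ) * n' + 1) * ((((F.P Kt).d - 1 : ℕ) : ℝ) * n' * ((12 * (F.P Kt).d * (n + 2) ^ 2 + 1) * e) + 3 * (F.P Kt).d * (n + 2) ^ 2 * e)) →
      ∀ U₀ : GaugeField (F.P Kt) 0 SU2,
        IsMinimizer (Node00.avOfRecord F 2 Kt) (Node00.regMSCoPOfRecord F 2 ν Kt k (maxDomT ν.M₁ Z)) (Bj ν.M₁ Z k)
          (avgFamily (Node00.avOfRecord F 2 Kt) (qsstarGIter0 k (ext Vk))) U₀ →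
        PlaqSmallOn S (cP * e) U₀)
    (hSΩ : ∀ b : PBond (F.P Kt) 0, b.src ∈ maxDomT ν.M₁ Z 1 → b.tgt ∈ maxDomT ν.M₁ Z 1 →
      (boxPlaqs (fun κ => ((b.src κ).val : ℤ) - (((2 * max (ℓs b.src) (ℓs b.tgt) + 1 + ℓb b) + ℓs b.src : ℕ) : ℤ))
          (fun κ => ((b.src κ).val : ℤ) + (((2 * max (ℓs b.src) (ℓs b.tgt) + 1 + ℓb b) + ℓs b.src : ℕ) : ℤ) + 2) : Set (Plaq (F.P Kt) 0)) ⊆ S)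
    -- DISPLAYED, LINEAR IN THE GUARD: the root-transporter letter ([15] (16)–(18) between the points of `𝔅_k`), for every guarded base field and every minimiser
    (hT : ∀ e : ℝ, 0 < e → e ≤ e₀ → ∀ (Vk : GaugeField (F.P Kt) k SU2), PlaqSmallOn (plaqsInside (pts k (Z ∩ Λᶜ))) e Vk →
      (∀ b ∈ (boxBonds LO HI : Set (PBond (F.P Kt) k)), dist1 (ext Vk b) ≤
        (((F.P Kt).d : ℝ) * n' + 1) * ((((F.P Kt).d - 1 : ℕ) : ℝ) * n' * ((12 * (F.P Kt).d * (n + 2) ^ 2 + 1) * e) + 3 * (F.P Kt).d * (n + 2) ^ 2 * e)) →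
      ∀ U₀ : GaugeField (F.P Kt) 0 SU2,
        IsMinimizer (Node00.avOfRecord F 2 Kt) (Node00.regMSCoPOfRecord F 2 ν Kt k (maxDomT ν.M₁ Z)) (Bj ν.M₁ Z k)
          (avgFamily (Node00.avOfRecord F 2 Kt) (qsstarGIter0 k (ext Vk))) U₀ →
        ∀ b : PBond (F.P Kt) 0, b.src ∈ maxDomT ν.M₁ Z 1 → b.tgt ∈ maxDomT ν.M₁ Z 1 → root b.src ≠ root b.tgt →
          ∃ (Ωw : List (Letter (F.P Kt).d)) (g : SU2), walkEnd (root b.src) Ωw = root b.tgt ∧ Ωw.length ≤ ℓb b ∧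
            dist1 (holAt U₀ (walk (root b.src) Ωw) * g⁻¹) ≤ cT * e ∧ dist1 g ≤ cG * e) :
    ∀ e : ℝ, 0 < e → e ≤ e₀ → ∀ (Vk : GaugeField (F.P Kt) k SU2), PlaqSmallOn (plaqsInside (pts k (Z ∩ Λᶜ))) e Vk →
      (∀ b ∈ (boxBonds LO HI : Set (PBond (F.P Kt) k)), dist1 (ext Vk b) ≤
        (((F.P Kt).d : ℝ) * n' + 1) * ((((F.P Kt).d - 1 : ℕ) : ℝ) * n' * ((12 * (F.P Kt).d * (n + 2) ^ 2 + 1) * e) + 3 * (F.P Kt).d * (n + 2) ^ 2 * e)) →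
      ∀ U₀ : GaugeField (F.P Kt) 0 SU2,
        IsMinimizer (Node00.avOfRecord F 2 Kt) (Node00.regMSCoPOfRecord F 2 ν Kt k (maxDomT ν.M₁ Z)) (Bj ν.M₁ Z k)
          (avgFamily (Node00.avOfRecord F 2 Kt) (qsstarGIter0 k (ext Vk))) U₀ →
        ∃ σ : GaugeTransf (F.P Kt) 0 SU2,
          (∀ j, j ≤ k → ∀ b ∈ bondsOf (Bj ν.M₁ Z k j), toMS σ j b.src = 1 ∧ toMS σ j b.tgt = 1) ∧
            (∀ p : Plaq (F.P Kt) 0, ((⟨p.src, p.μ⟩ : PBond (F.P Kt) 0) ∈ {b : PBond (F.P Kt) 0 | b.src ∈ maxDomT ν.M₁ Z 1} ∨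
                (⟨p.src.shift p.μ, p.ν⟩ : PBond (F.P Kt) 0) ∈ {b : PBond (F.P Kt) 0 | b.src ∈ maxDomT ν.M₁ Z 1} ∨
                (⟨p.src.shift p.ν, p.μ⟩ : PBond (F.P Kt) 0) ∈ {b : PBond (F.P Kt) 0 | b.src ∈ maxDomT ν.M₁ Z 1} ∨
                (⟨p.src, p.ν⟩ : PBond (F.P Kt) 0) ∈ {b : PBond (F.P Kt) 0 | b.src ∈ maxDomT ν.M₁ Z 1}) →
              ‖((gaugeAct σ U₀ ⟨p.src, p.μ⟩ : SU2) : Matrix (Fin 2) (Fin 2) ℂ) - 1‖ ≤ (((((F.P Kt).d : ℝ) * n' + 1) * ((((F.P Kt).d - 1 : ℕ) : ℝ) * n' * (12 * (F.P Kt).d * (n + 2) ^ 2 + 1) + 3 * (F.P Kt).d * (n + 2) ^ 2)) + (((2 * ℓ + 1 + ℓT : ℕ) : ℝ)) ^ 2 / 4 * cP + cT + cG) * e ∧ ‖((gaugeAct σ U₀ ⟨p.src.shift p.μ, p.ν⟩ : SU2) : Matrix (Fin 2) (Fin 2) ℂ) - 1‖ ≤ (((((F.P Kt).d : ℝ) *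 n' + 1) * ((((F.P Kt).d - 1 : ℕ) : ℝ) * n' * (12 * (F.P Kt).d * (n + 2) ^ 2 + 1) + 3 * (F.P Kt).d * (n + 2) ^ 2)) + (((2 * ℓ + 1 + ℓT : ℕ) : ℝ)) ^ 2 / 4 * cP + cT + cG) * e ∧
                ‖((gaugeAct σ U₀ ⟨p.src.shift p.ν, p.μ⟩ : SU2) : Matrix (Fin 2) (Fin 2) ℂ) - 1‖ ≤ (((((F.P Kt).d : ℝ) * n' + 1) * ((((F.P Kt).d - 1 : ℕ) : ℝ) * n' * (12 * (F.P Kt).d * (n + 2) ^ 2 + 1) + 3 * (F.P Kt).d * (n + 2) ^ 2)) + (((2 * ℓ + 1 + ℓT : ℕ) : ℝ)) ^ 2 / 4 * cP + cT + cG) * e ∧ ‖((gaugeAct σ U₀ ⟨p.src, p.ν⟩ : SU2) : Matrix (Fin 2) (Fin 2) ℂ) - 1‖ ≤ (((((F.P Kt).d : ℝ) * n' + 1) * ((((F.P Kt).d - 1 : ℕ) : ℝ) * n' * (12 * (F.P Kt).d * (n + 2) ^ 2 + 1) + 3 * (F.P Kt).d * (n + 2) ^ 2)) + (((2 * ℓ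 + 1 + ℓT : ℕ) : ℝ)) ^ 2 / 4 * cP + cT + cG) * e) ∧
          (∀ b ∈ inputs (Bj ν.M₁ Z k), b ∈ N → ‖((gaugeAct σ U₀ b : SU2) : Matrix (Fin 2) (Fin 2) ℂ) - 1‖ ≤ (((((F.P Kt).d : ℝ) * n' + 1) * ((((F.P Kt).d - 1 : ℕ) : ℝ) * n' * (12 * (F.P Kt).d * (n + 2) ^ 2 + 1) + 3 * (F.P Kt).d * (n + 2) ^ 2)) + (((2 * ℓ + 1 + ℓT : ℕ) : ℝ)) ^ 2 / 4 * cP + cT + cG) * e) := by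
  intro e he hee₀ Vk hV hD U₀ hU₀
  have hρn : (0 : ℝ) ≤ ((((F.P Kt).d : ℝ) * n' + 1) * ((((F.P Kt).d - 1 : ℕ) : ℝ) * n' * (12 * (F.P Kt).d * (n + 2) ^ 2 + 1) + 3 * (F.P Kt).d * (n + 2) ^ 2)) * e := by positivity
  have hεP : (0 : ℝ) ≤ cP * e := mul_nonneg hcP he.le
  have heT : (0 : ℝ) ≤ cT * e := mul_nonneg hcT he.le
  have hdG : (0 : ℝ) ≤ cG * e := mul_nonneg hcG he.le
  -- the datum premise in the producer's `ρn` spelling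
  have hD' : ∀ c ∈ (boxBonds LO HI : Set (PBond (F.P Kt) k)), dist1 (ext Vk c) ≤ ((((F.P Kt).d : ℝ) * n' + 1) * ((((F.P Kt).d - 1 : ℕ) : ℝ) * n' * (12 * (F.P Kt).d * (n + 2) ^ 2 + 1) + 3 * (F.P Kt).d * (n + 2) ^ 2)) * e := by
    intro c hc
    have key : (((F.P Kt).d : ℝ) * n' + 1) * ((((F.P Kt).d - 1 : ℕ) : ℝ) * n' * ((12 * (F.P Kt).d * (n + 2) ^ 2 + 1) * e) + 3 * (F.P Kt).d * (n + 2) ^ 2 * e)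
        = ((((F.P Kt).d : ℝ) * n' + 1) * ((((F.P Kt).d - 1 : ℕ) : ℝ) * n' * (12 * (F.P Kt).d * (n + 2) ^ 2 + 1) + 3 * (F.P Kt).d * (n + 2) ^ 2)) * e := by ring
    exact (hD c hc).trans key.le
  obtain ⟨σ, hu, hC1, hCin⟩ := exists_gaugeLetterLoc_atRecord_of_forestPackage ν Kt hk0 hk Z path root hF2 hwalk hpkg hcov ℓs hℓs ℓb hcapS hcapB hN
    hρn (ext Vk) (boxBonds LO HI : Set (PBond (F.P Kt) k)) hD' hU₀ N hGN hN1 hεP (hP e he hee₀ Vk hV hD U₀ hU₀) hSΩ heT hdG (hT e he hee₀ Vk hV hD U₀ hU₀)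
  -- the assembled tolerance is below the linear modulus
  have hle : max (((((F.P Kt).d : ℝ) * n' + 1) * ((((F.P Kt).d - 1 : ℕ) : ℝ) * n' * (12 * (F.P Kt).d * (n + 2) ^ 2 + 1) + 3 * (F.P Kt).d * (n + 2) ^ 2)) * e) ((((2 * ℓ + 1 + ℓT : ℕ) : ℝ)) ^ 2 / 4 * (cP * e) + cT * e + cG * e) ≤ (((((F.P Kt).d : ℝ) * n' + 1) * ((((F.P Kt).d - 1 : ℕ) : ℝ) * n' * (12 * (F.P Kt).d * (n + 2) ^ 2 + 1) + 3 * (F.P Kt).d * (n + 2) ^ 2)) + (((2 * ℓ + 1 + ℓT : ℕ) : ℝ)) ^ 2 / 4 * cP + cT + cG) * e := by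
    have h1 : (0 : ℝ) ≤ (((2 * ℓ + 1 + ℓT : ℕ) : ℝ)) ^ 2 / 4 * (cP * e) := by positivity
    refine max_le ?_ ?_ <;> nlinarith
  refine ⟨σ, hu, fun p hp => ?_, fun b hb hbN => (hCin b hb hbN).trans hle⟩
  obtain ⟨h₁, h₂, h₃, h₄⟩ := hC1 p hp
  exact ⟨h₁.trans hle, h₂.trans hle, h₃.trans hle, h₄.trans hle⟩

/-! ## §2  The ∀δ∃e socket of the assembled endpoints, from the forest package -/

/-- ★★ **THE `hσN` SOCKET OF `…AssembledOfGaugeLetterAtToleranceLoc(OfChartLetterN)` FROM THE FOREST PACKAGE AND THE TWO LINEAR LETTERS** — §1 followed by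
`B15Prop1GaugeLetterTargetOfLinearBudgets.forall_target_exists_guard_of_linear`: for every target tolerance a guard.  The knit writes, per instance,
`hσN := fun i => hσN_of_forestPackage_linear …`.
[cite: Balaban1989LargeFieldI, Prop. 1 p.194 («for ε > 0 sufficiently small»); Balaban1985Variational, (4) p.278, Thm 1 (8) p.279, (16)–(18) p.280; Balaban1988Convergent, (2.2) p.255, (2.11)–(2.13) pp.256–257] -/
theorem hσN_of_forestPackage_linear {F : T4Family} (ν : Node00.Stage7Numerics) (Kt : ℕ) {k : ℕ} (hk0 : 0 < k)
    (hk : k ≤ (F.P Kt).m + (F.P Kt).K) (Z : Set (Site (F.P Kt) 0))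
    -- the rooted tower forest package, by shape
    (path : Site (F.P Kt) 0 → List (LStep (F.P Kt) 0)) (root : Site (F.P Kt) 0 → Site (F.P Kt) 0)
    (hF2 : ∀ j, j ≤ k → ∀ c ∈ bondsOf (Bj ν.M₁ Z k j), path (embIter j c.src) = [] ∧ path (embIter j c.tgt) = [])
    (hwalk : ∀ x, path x = walk (root x) ((path x).map fun s => (s.bond.dir, s.fwd)) ∧
      walkEnd (root x) ((path x).map fun s => (s.bond.dir, s.fwd)) = x)
    (hpkg : ∀ (z : Site (F.P Kt) 0) (j : ℕ), j ≤ k →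
      embIter j (iterBlockOf j z) ∈ {z : Site (F.P Kt) 0 | ∃ j, j ≤ k ∧ ∃ c ∈ bondsOf ((Bj ν.M₁ Z k : DetSet (F.P Kt)) j), (z = embIter j c.src ∨ z = embIter j c.tgt)} →
      (∀ s ∈ path z, iterBlockOf j s.bond.src = iterBlockOf j z ∧ iterBlockOf j s.bond.tgt = iterBlockOf j z) ∧
      (path z).length ≤ ∑ i ∈ Finset.range (j + 1), ((F.P Kt).d * (((F.P Kt).L ^ i - 1) / 2) + 1) ∧
      (∀ ν', netDisp ((path z).map fun s => (s.bond.dir, s.fwd)) ν' = ((z ν').val : ℤ) - ((root z ν').val : ℤ)) ∧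
      iterBlockOf j (root z) = iterBlockOf j z)
    (hcov : ∀ z : Site (F.P Kt) 0, ∃ J, J ≤ k ∧ iterBlockOf J z ∈ (Bj ν.M₁ Z k : DetSet (F.P Kt)) J)
    -- budgets: per-site word bounds, per-bond transporter bounds, uniform caps (no wrapping)
    (ℓs : Site (F.P Kt) 0 → ℕ) (hℓs : ∀ x ∈ maxDomT ν.M₁ Z 1, (path x).length ≤ ℓs x)
    (ℓb : PBond (F.P Kt) 0 → ℕ) {ℓ ℓT : ℕ} (hcapS : ∀ x ∈ maxDomT ν.M₁ Z 1, ℓs x ≤ ℓ)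
    (hcapB : ∀ b : PBond (F.P Kt) 0, b.src ∈ maxDomT ν.M₁ Z 1 → b.tgt ∈ maxDomT ν.M₁ Z 1 → ℓb b ≤ ℓT) (hN : 2 * ℓ + 1 + ℓT < (F.P Kt).sitesPerDir 0)
    -- the socket's objects: the base fields' extension `ext`, the complement box `Λ`, the region box `[LO, HI]` with sizes `n n'` (datum tolerance `ρlin·e`, the endpoints' `hρn` text)
    (Λ : Set (Site (F.P Kt) 0)) (ext : GaugeField (F.P Kt) k SU2 → GaugeField (F.P Kt) k SU2) (LO HI : Fin (F.P Kt).d → ℤ) (n n' : ℕ)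
    -- geometry of the neighbourhood
    (N : Set (PBond (F.P Kt) 0))
    (hGN : ∀ b ∈ N, (b.src ∉ maxDomT ν.M₁ Z 1 ∨ b.tgt ∉ maxDomT ν.M₁ Z 1) → blockIter k b.tgt ≠ blockIter k b.src →
      (⟨blockIter k b.src, b.dir⟩ : PBond (F.P Kt) k) ∈ (boxBonds LO HI : Set (PBond (F.P Kt) k)))
    (hN1 : ∀ p : Plaq (F.P Kt) 0, ((⟨p.src, p.μ⟩ : PBond (F.P Kt) 0) ∈ {b : PBond (F.P Kt) 0 | b.src ∈ maxDomT ν.M₁ Z 1} ∨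
        (⟨p.src.shift p.μ, p.ν⟩ : PBond (F.P Kt) 0) ∈ {b : PBond (F.P Kt) 0 | b.src ∈ maxDomT ν.M₁ Z 1} ∨
        (⟨p.src.shift p.ν, p.μ⟩ : PBond (F.P Kt) 0) ∈ {b : PBond (F.P Kt) 0 | b.src ∈ maxDomT ν.M₁ Z 1} ∨
        (⟨p.src, p.ν⟩ : PBond (F.P Kt) 0) ∈ {b : PBond (F.P Kt) 0 | b.src ∈ maxDomT ν.M₁ Z 1}) →
      (⟨p.src, p.μ⟩ : PBond (F.P Kt) 0) ∈ N ∧ (⟨p.src.shift p.μ, p.ν⟩ : PBond (F.P Kt) 0) ∈ N ∧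
        (⟨p.src.shift p.ν, p.μ⟩ : PBond (F.P Kt) 0) ∈ N ∧ (⟨p.src, p.ν⟩ : PBond (F.P Kt) 0) ∈ N)
    -- the reference guard and the LINEAR budgets of the two displayed letters
    {e₀ cP cT cG : ℝ} (he₀ : 0 < e₀) (hcP : 0 ≤ cP) (hcT : 0 ≤ cT) (hcG : 0 ≤ cG)
    -- DISPLAYED, LINEAR IN THE GUARD: the graded root-free plaquette letter ((1.7) ∕ [15] Thm 1 at the minimiser) on `S`, for every guarded base field and every minimiser
    {S : Set (Plaq (F.P Kt) 0)}
    (hP : ∀ e : ℝ, 0 < e → e ≤ e₀ → ∀ (Vk : GaugeField (F.P Kt) k SU2), PlaqSmallOn (plaqsInside (pts k (Z ∩ Λᶜ))) e Vk →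
      (∀ b ∈ (boxBonds LO HI : Set (PBond (F.P Kt) k)), dist1 (ext Vk b) ≤
        (((F.P Kt).d : ℝ) * n' + 1) * ((((F.P Kt).d - 1 : ℕ) : ℝ) * n' * ((12 * (F.P Kt).d * (n + 2) ^ 2 + 1) * e) + 3 * (F.P Kt).d * (n + 2) ^ 2 * e)) →
      ∀ U₀ : GaugeField (F.P Kt) 0 SU2,
        IsMinimizer (Node00.avOfRecord F 2 Kt) (Node00.regMSCoPOfRecord F 2 ν Kt k (maxDomT ν.M₁ Z)) (Bj ν.M₁ Z k)
          (avgFamily (Node00.avOfRecord F 2 Kt) (qsstarGIter0 k (ext Vk))) U₀ →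
        PlaqSmallOn S (cP * e) U₀)
    (hSΩ : ∀ b : PBond (F.P Kt) 0, b.src ∈ maxDomT ν.M₁ Z 1 → b.tgt ∈ maxDomT ν.M₁ Z 1 →
      (boxPlaqs (fun κ => ((b.src κ).val : ℤ) - (((2 * max (ℓs b.src) (ℓs b.tgt) + 1 + ℓb b) + ℓs b.src : ℕ) : ℤ))
          (fun κ => ((b.src κ).val : ℤ) + (((2 * max (ℓs b.src) (ℓs b.tgt) + 1 + ℓb b) + ℓs b.src : ℕ) : ℤ) + 2) : Set (Plaq (F.P Kt) 0)) ⊆ S)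
    -- DISPLAYED, LINEAR IN THE GUARD: the root-transporter letter ([15] (16)–(18) between the points of `𝔅_k`), for every guarded base field and every minimiser
    (hT : ∀ e : ℝ, 0 < e → e ≤ e₀ → ∀ (Vk : GaugeField (F.P Kt) k SU2), PlaqSmallOn (plaqsInside (pts k (Z ∩ Λᶜ))) e Vk →
      (∀ b ∈ (boxBonds LO HI : Set (PBond (F.P Kt) k)), dist1 (ext Vk b) ≤
        (((F.P Kt).d : ℝ) * n' + 1) * ((((F.P Kt).d - 1 : ℕ) : ℝ) * n' * ((12 * (F.P Kt).d * (n + 2) ^ 2 + 1) * e) + 3 * (F.P Kt).d * (n + 2) ^ 2 * e)) →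
      ∀ U₀ : GaugeField (F.P Kt) 0 SU2,
        IsMinimizer (Node00.avOfRecord F 2 Kt) (Node00.regMSCoPOfRecord F 2 ν Kt k (maxDomT ν.M₁ Z)) (Bj ν.M₁ Z k)
          (avgFamily (Node00.avOfRecord F 2 Kt) (qsstarGIter0 k (ext Vk))) U₀ →
        ∀ b : PBond (F.P Kt) 0, b.src ∈ maxDomT ν.M₁ Z 1 → b.tgt ∈ maxDomT ν.M₁ Z 1 → root b.src ≠ root b.tgt →
          ∃ (Ωw : List (Letter (F.P Kt).d)) (g : SU2), walkEnd (root b.src) Ωw = root b.tgt ∧ Ωw.length ≤ ℓb b ∧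
            dist1 (holAt U₀ (walk (root b.src) Ωw) * g⁻¹) ≤ cT * e ∧ dist1 g ≤ cG * e) :
        ∀ δ : ℝ, 0 < δ → ∃ e : ℝ, 0 < e ∧ ∀ (Vk : GaugeField (F.P Kt) k SU2), PlaqSmallOn (plaqsInside (pts k (Z ∩ Λᶜ))) e Vk →
      (∀ b ∈ (boxBonds LO HI : Set (PBond (F.P Kt) k)), dist1 (ext Vk b) ≤
        (((F.P Kt).d : ℝ) * n' + 1) * ((((F.P Kt).d - 1 : ℕ) : ℝ) * n' * ((12 * (F.P Kt).d * (n + 2) ^ 2 + 1) * e) + 3 * (F.P Kt).d * (n + 2) ^ 2 * e)) →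
      ∀ U₀ : GaugeField (F.P Kt) 0 SU2,
        IsMinimizer (Node00.avOfRecord F 2 Kt) (Node00.regMSCoPOfRecord F 2 ν Kt k (maxDomT ν.M₁ Z)) (Bj ν.M₁ Z k)
          (avgFamily (Node00.avOfRecord F 2 Kt) (qsstarGIter0 k (ext Vk))) U₀ →
        ∃ σ : GaugeTransf (F.P Kt) 0 SU2,
          (∀ j, j ≤ k → ∀ b ∈ bondsOf (Bj ν.M₁ Z k j), toMS σ j b.src = 1 ∧ toMS σ j b.tgt = 1) ∧
            (∀ p : Plaq (F.P Kt) 0, ((⟨p.src, p.μ⟩ : PBond (F.P Kt) 0) ∈ {b : PBond (F.P Kt) 0 | b.src ∈ maxDomT ν.M₁ Z 1} ∨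
                (⟨p.src.shift p.μ, p.ν⟩ : PBond (F.P Kt) 0) ∈ {b : PBond (F.P Kt) 0 | b.src ∈ maxDomT ν.M₁ Z 1} ∨
                (⟨p.src.shift p.ν, p.μ⟩ : PBond (F.P Kt) 0) ∈ {b : PBond (F.P Kt) 0 | b.src ∈ maxDomT ν.M₁ Z 1} ∨
                (⟨p.src, p.ν⟩ : PBond (F.P Kt) 0) ∈ {b : PBond (F.P Kt) 0 | b.src ∈ maxDomT ν.M₁ Z 1}) →
              ‖((gaugeAct σ U₀ ⟨p.src, p.μ⟩ : SU2) : Matrix (Fin 2) (Fin 2) ℂ) - 1‖ ≤ δ ∧ ‖((gaugeAct σ U₀ ⟨p.src.shift p.μ, p.ν⟩ : SU2) : Matrix (Fin 2) (Fin 2) ℂ) - 1‖ ≤ δ ∧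
                ‖((gaugeAct σ U₀ ⟨p.src.shift p.ν, p.μ⟩ : SU2) : Matrix (Fin 2) (Fin 2) ℂ) - 1‖ ≤ δ ∧ ‖((gaugeAct σ U₀ ⟨p.src, p.ν⟩ : SU2) : Matrix (Fin 2) (Fin 2) ℂ) - 1‖ ≤ δ) ∧
          (∀ b ∈ inputs (Bj ν.M₁ Z k), b ∈ N → ‖((gaugeAct σ U₀ b : SU2) : Matrix (Fin 2) (Fin 2) ℂ) - 1‖ ≤ δ) := by
  have hC : (0 : ℝ) ≤ (((((F.P Kt).d : ℝ) * n' + 1) * ((((F.P Kt).d - 1 : ℕ) : ℝ) * n' * (12 * (F.P Kt).d * (n + 2) ^ 2 + 1) + 3 * (F.P Kt).d * (n + 2) ^ 2)) + (((2 * ℓ + 1 + ℓT : ℕ) : ℝ)) ^ 2 / 4 * cP + cT + cG) := by positivity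
  exact forall_target_exists_guard_of_linear ν Kt Z Λ ext LO HI n n' N he₀ hC
    (hlin_of_forestPackage_linear ν Kt hk0 hk Z path root hF2 hwalk hpkg hcov ℓs hℓs ℓb hcapS hcapB hN Λ ext LO HI n n' N hGN hN1 hcP hcT hcG hP hSΩ hT)

end Literature.MathematicalPhysics.QuantumFieldTheory.Balaban1983to89.B15Prop1GaugeLetterSocketOfForestPackage

end
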